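import Literature.Geometry.Kaehler.ComplexTorusWeylOperatorLefschetzProjectors
import Literature.Geometry.Kaehler.ComplexTorusLefschetzSL2ActionLattices
import Literature.Geometry.Kaehler.ComplexTorusRationalLefschetzDecomposition
import HarnessLib

/-!
# The Weyl operator is defined over `ℚ` for every non-degenerate rational `(1,1)`-class, and carries the RATIONAL Lefschetz summand
# `Lʳ H^{s−2r}(X, ℚ)_prim ⊂ Hˢ(X, ℚ)` onto `L^{g−s+r} H^{s−2r}(X, ℚ)_prim ⊂ H^{2g−s}(X, ℚ)`

Layer `Literature/Geometry/Kaehler`, namespace `Literature.Geometry.Kaehler.ComplexTorus`; lane `lit-hodgefound` (Track 2 foundations library, Layer A1/A4),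
prover seat `lit-hodgefound-p35` (generation 47, row g47-#3; sequel of ✔ g47-#1 `ComplexTorusWeylOperatorLefschetzProjectors`). THEOREMS ONLY (no definition,
no named fact, no instance, no notation; D-0026 net debt `0`).

CONSUMED BY NAME, nothing restated: p09's Weyl operator `w = (hasLefschetzProperty_lefschetzG hη).weylOperator isZGrading_countingG` on `H•(X; ℂ) = GForm E ℂ`, its
string formula `weylOperator_of_lefschetzPow_of_mem_primitiveForms` (row g52-#2), its homogeneity `weylOperator_of_eq_of` (row g51-#10), `w² = (−1)^m` on `M_m`
(`weylOperator_weylOperator_apply_of_mem`), injectivity `weylOperator_of_apply_injective`; p09's row g52-#1 `ComplexTorusLefschetzSL2ActionLattices`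
(`sl2Rep_map_intCast_mem_rationalEnd`: `ρ(SL₂(ℤ)) ⊆ GL(H•(X; ℚ))` for `η ∈ NS_ℚ(X)`; the abstract `sl2Rep_apply_of_coe_eq_weyl`: `ρ(0 −1 ; 1 0) = w`) and its rational
structure `rationalFormsG Φ = H•(X; ℚ)`, `rationalEnd Φ = 𝔤𝔩(H•(X; ℚ))` (`ComplexTorusNeronSeveriLieAlgebraDefinedOverQ`); the tree's RATIONAL LEFSCHETZ SUMMANDS
`lefschetzSummand Φ hηQ k r = Lʳ H^{k−2r}(X, ℚ)_prim ⊂ Hᵏ(X, ℚ) = rationalForms Φ k` (`ComplexTorusRationalLefschetzDecomposition`: `lefschetzSummand_eq` — the image of the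
rational primitive classes `primitiveRationalForms Φ η m` under `ratLefschetzPow r`, `2r + m = k`; `lefschetzSummand_eq_bot`), and row g47-#1 (Milne's range `lefschetzRange`).

SETTING. `X = E/Φ(ℤ^ι)` a complex torus of dimension `g`, `η` a non-degenerate real `2`-form; `hQ : η ∈ neronSeveriQ Φ` (a rational `(1,1)`-class, e.g. any `η ∈ NS(X)`)
for §1, `hηQ : ofRealForm η ∈ rationalForms Φ 2` (a rational class) for §2. The rational summands are read inside `Hᵏ(X, ℂ)` through
`(lefschetzSummand Φ hηQ k r).map (rationalForms Φ k).subtype` (a `ℚ`-subspace of the complex forms), so that no proof term enters a statement. Index bookkeeping as in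
row g47-#1: `s + t = 2g`, `r` in Milne's range of `Hˢ`, `r + g = r' + s`.

## What is proved

* §1 **THE WEYL OPERATOR IS DEFINED OVER `ℚ`**: `weylOperator_mem_rationalEnd` — `w ∈ 𝔤𝔩(H•(X; ℚ))` for every non-degenerate `η ∈ NS_ℚ(X)` (`w = ρ(S)`, `S = (0 −1 ; 1 0) ∈
  SL₂(ℤ)`, and p09's `ρ(SL₂(ℤ)) ⊆ GL(H•(X; ℚ))`); hence `w(H•(X; ℚ)) ⊆ H•(X; ℚ)` (`weylOperator_apply_mem_rationalFormsG`) and **`w(Hᵏ(X, ℚ)) ⊆ H^{2g−k}(X, ℚ)`**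
  componentwise (`weylOperator_of_apply_mem_rationalForms`) — Looijenga–Lunts (1.7) "if `M` is defined over a subfield … `𝔤(𝔞, M)` is also defined over" it; Beauville: `SL₂`
  acts "on the `ℚ`-vector space `CH(A)`". (p09's row g51-#7 `IsPolarizationType.exists_mem_rationalForms_weylOperator_of_eq` has this for Riemann forms through the Fourier
  transform; here for every non-degenerate rational `(1,1)`-class, through `ρ(SL₂(ℤ))`.)
* §2 **`w(Lʳ H^{s−2r}(X, ℚ)_prim) = L^{g−s+r} H^{s−2r}(X, ℚ)_prim`**: for `η` rational non-degenerate, `s + t = 2g`, `r` in Milne's range of `Hˢ`, `r + g = r' + s`: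
  `weylOperator_of_apply_mem_map_lefschetzSummand` (into: a class `Lʳδ`, `δ ∈ H^{s−2r}(X, ℚ)_prim`, goes to the RATIONAL multiple `(−1)^{r'} r!/r'! · L^{r'}δ` — the string
  formula — of a member of the partner summand; no descent argument is needed, in any degree), **`map_weylOperator_of_map_lefschetzSummand`** (onto, as an equality of
  `ℚ`-subspaces of `Hᵗ(X, ℂ)`: the preimage of `y` is `± w(y)_s`), **`bijOn_weylOperator_of_map_lefschetzSummand`** (`w : Lʳ H^{s−2r}(X, ℚ)_prim ⥲ L^{r'} H^{s−2r}(X, ℚ)_prim`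
  is a bijection), and the `NS(X)` / Riemann-form readings `IsNSForm.…`, `IsRiemannForm.…` — Voisin §7.1.2: for an integral Kähler class the Lefschetz decomposition is one
  "of rational sub-Hodge structures", and the Weyl element of its `𝔰𝔩₂` permutes these rational pieces (`Lʳ H^{k}(X, ℚ)_prim ↦ L^{g−k−r} H^{k}(X, ℚ)_prim`).

## Sources, verbatim

* E. Looijenga, V. A. Lunts, *A Lie algebra attached to a projective variety*, Invent. Math. 129 (1997), held `paper:arxiv-alg-geom_9604014`, §1 (1.7): "if `M` is defined
  over a subfield `ℚ ⊂ K` […] `𝔤(𝔞, M)` is as a Lie subalgebra of `𝔤𝔩(M)` also defined over `ℚ`".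
* A. Beauville, *The action of `SL₂` on abelian varieties* (2010), held `paper:arxiv-0805.1541`, Introduction / §4 Theorem ("the group `SL₂` acts on the `ℚ`-vector space
  `CH(A)` […] `(0 −1 ; 1 0)·z = ℱ(z)`"), §5 Corollary ("`ℱ(θ^q/q! · z) = ((−θ)^r/r!) z`").
* C. Voisin, *Hodge Theory and Complex Algebraic Geometry I* (CUP 2002), §7.1.2 (PDF p. 134): "when the operator `L` preserves the rational cohomology" the Lefschetz
  decomposition is a decomposition "of rational sub-Hodge structures"; §6.2.3 Cor. 6.26.
* Y. André, *Pour une théorie inconditionnelle des motifs* (1996), held `paper:doi-10-1007-bf02698643`, §1.1–§1.2 (p. 10–11): `*_L`, `*_H` via the Lefschetz decomposition;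
  "l'élément `(0 1 ; −1 0)` de `SL₂` s'envoie sur `± *_H`"; Prop. 1.2 ("Les sous-algèbres `ℚ[L, *_L]`, `ℚ[L, *_H]`, […] `ℚ[L, Λ]` de `End H(X)` sont égales").
* J. S. Milne, *Lefschetz classes on abelian varieties*, Duke Math. J. 96 (1999), §5 p. 664–665 (Milne's range `i ≥ s − d`; "all elements of the `ℚ`-algebra `ℚ[L, Λ]`").
* H. Lange, *Abelian Varieties over the Complex Numbers* (2023), §7.3.2 (1)–(3) (p0338 L3–L16); §5.4.1 Thm. 5.4.2, (5.22).

## References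

* [LooijengaLunts1997] E. Looijenga, V. A. Lunts, A Lie algebra attached to a projective variety, Invent. Math. 129 (1997) — §1 (1.1), (1.7).
* [Beauville2010SL2] A. Beauville, The action of SL₂ on abelian varieties, J. Ramanujan Math. Soc. 25 (2010) — §4 Theorem, §5 Corollary.
* [VoisinHodgeI2002] C. Voisin, Hodge Theory and Complex Algebraic Geometry I, CUP 2002 — §6.2.3 Cor. 6.26; §7.1.2 (PDF p. 134).
* [Andre1996Motifs] Y. André, Pour une théorie inconditionnelle des motifs, Publ. Math. IHÉS 83 (1996) — §1.1, §1.2 (p. 11), Prop. 1.2.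
* [Milne1999LefschetzClasses] J. S. Milne, Lefschetz classes on abelian varieties, Duke Math. J. 96 (1999) — §5 p. 664–665, Thm. 5.9.
* [Lange2023AbelianVarietiesComplex] H. Lange, Abelian Varieties over the Complex Numbers, Springer 2023 — §7.3.2 (1)–(3); §5.4.1 Thm. 5.4.2, (5.22).
* [Huybrechts2005] D. Huybrechts, Complex Geometry. An Introduction, Springer 2005 — §1.2 Prop. 1.2.30 (i), Prop. 1.2.31.
-/

noncomputable section

-- `Module ℂ` / `SMulZeroClass ℂ` synthesis on `E [⋀^Fin k]→L[ℝ] ℂ` (as in `ComplexTorusLefschetzDecomposition`)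
set_option maxSynthPendingDepth 3

namespace Literature.Geometry.Kaehler

namespace ComplexTorus

open Module Function Finset
open scoped MatrixGroups
open Literature.LinearAlgebra.Alternating Literature.Algebra.Lie

universe uE

variable {ι : Type*} [Fintype ι] [DecidableEq ι] {E : Type uE} [NormedAddCommGroup E] [NormedSpace ℂ E] [FiniteDimensional ℂ E] [Nontrivial E]
  (Φ : (ι → ℝ) ≃L[ℝ] E) {η : E [⋀^Fin 2]→L[ℝ] ℝ}

/-! ## §1 `w` is defined over `ℚ`: `w ∈ 𝔤𝔩(H•(X; ℚ))`, `w(Hᵏ(X, ℚ)) ⊆ H^{2g−k}(X, ℚ)` -/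

omit [Fintype ι] [DecidableEq ι] [FiniteDimensional ℂ E] [Nontrivial E] in
/-- The image of Mathlib's `S = (0 −1 ; 1 0) ∈ SL₂(ℤ)` in `SL₂(ℂ)` is the Weyl element. [cite: Beauville2010SL2, §2 ("`w = (0 −1 ; 1 0)`")] -/
private theorem coe_modularS₄₇ : (((ModularGroup.S : SL(2, ℤ)) : SL(2, ℂ)) : Matrix (Fin 2) (Fin 2) ℂ) = !![0, -1; 1, 0] := by
  rw [Matrix.SpecialLinearGroup.coe_matrix_coe, ModularGroup.coe_S]
  ext i j; fin_cases i <;> fin_cases j <;> simp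

/-- **THE WEYL OPERATOR IS DEFINED OVER `ℚ`: `w ∈ 𝔤𝔩(H•(X; ℚ))`** for every non-degenerate rational `(1,1)`-class `η ∈ NS_ℚ(X)` — `w = ρ(S)` for the generator
`S = (0 −1 ; 1 0)` of `SL₂(ℤ)` (`sl2Rep_apply_of_coe_eq_weyl`) and `ρ(SL₂(ℤ))` consists of rational operators (p09's `sl2Rep_map_intCast_mem_rationalEnd`:
`ρ(1 q ; 0 1) = exp(q L_η)`, `ρ(1 0 ; q 1) = exp(q Λ_η)` are rational). [cite: LooijengaLunts1997, §1 (1.7)] [cite: Beauville2010SL2, §4 Theorem ("`SL₂` acts on the `ℚ`-vector space")]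
[cite: Milne1999LefschetzClasses, §5 Thm. 5.9 (proof, p. 665: "all elements of the `ℚ`-algebra `ℚ[L, Λ]`")] -/
theorem weylOperator_mem_rationalEnd (hQ : η ∈ neronSeveriQ Φ) (hη : ∀ v : E, v ≠ 0 → ∃ w : E, η ![v, w] ≠ 0) :
    (hasLefschetzProperty_lefschetzG hη).weylOperator isZGrading_countingG ∈ rationalEnd Φ := by
  have h := sl2Rep_map_intCast_mem_rationalEnd Φ hQ hη ModularGroup.S
  rwa [(hasLefschetzProperty_lefschetzG hη).sl2Rep_apply_of_coe_eq_weyl isZGrading_countingG _ coe_modularS₄₇] at h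

/-- **`w(H•(X; ℚ)) ⊆ H•(X; ℚ)`.** [cite: LooijengaLunts1997, §1 (1.7)] [cite: Beauville2010SL2, §4 Theorem] -/
theorem weylOperator_apply_mem_rationalFormsG (hQ : η ∈ neronSeveriQ Φ) (hη : ∀ v : E, v ≠ 0 → ∃ w : E, η ![v, w] ≠ 0) {w : GForm E ℂ}
    (hw : w ∈ rationalFormsG Φ) : (hasLefschetzProperty_lefschetzG hη).weylOperator isZGrading_countingG w ∈ rationalFormsG Φ :=
  (mem_rationalEnd_iff Φ).1 (weylOperator_mem_rationalEnd Φ hQ hη) w hw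

/-- **`w(Hᵏ(X, ℚ)) ⊆ H^m(X, ℚ)` componentwise** (the only non-zero component is `m = 2g − k`): the Weyl operator of a non-degenerate rational `(1,1)`-class carries
rational classes to rational classes. [cite: LooijengaLunts1997, §1 (1.7)] [cite: Beauville2010SL2, §4 Theorem] [cite: VoisinHodgeI2002, §7.1.2 (PDF p. 134)] -/
theorem weylOperator_of_apply_mem_rationalForms (hQ : η ∈ neronSeveriQ Φ) (hη : ∀ v : E, v ≠ 0 → ∃ w : E, η ![v, w] ≠ 0) {k : ℕ}
    {x : E [⋀^Fin k]→L[ℝ] ℂ} (hx : x ∈ rationalForms Φ k) (m : ℕ) :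
    (hasLefschetzProperty_lefschetzG hη).weylOperator isZGrading_countingG (GForm.of k x) m ∈ rationalForms Φ m :=
  (mem_rationalFormsG_iff Φ).1 (weylOperator_apply_mem_rationalFormsG Φ hQ hη (of_mem_rationalFormsG Φ hx)) m

/-- **`w` carries `Hᵏ(X, ℚ)` into `H^{2g−k}(X, ℚ)` for every `η ∈ NS(X)` non-degenerate** (an integral `(1,1)`-class is a rational one).
[cite: VoisinHodgeI2002, §7.1.2 (PDF p. 134)] [cite: LooijengaLunts1997, §1 (1.7)] -/
theorem IsNSForm.weylOperator_of_apply_mem_rationalForms (hNS : IsNSForm Φ η) (hη : ∀ v : E, v ≠ 0 → ∃ w : E, η ![v, w] ≠ 0) {k : ℕ}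
    {x : E [⋀^Fin k]→L[ℝ] ℂ} (hx : x ∈ rationalForms Φ k) (m : ℕ) :
    (hasLefschetzProperty_lefschetzG hη).weylOperator isZGrading_countingG (GForm.of k x) m ∈ rationalForms Φ m :=
  ComplexTorus.weylOperator_of_apply_mem_rationalForms Φ (mem_neronSeveriQ_of_isNSForm Φ hNS) hη hx m

/-! ## §2 `w(Lʳ H^{s−2r}(X, ℚ)_prim) = L^{g−s+r} H^{s−2r}(X, ℚ)_prim` -/

omit [Fintype ι] [DecidableEq ι] [FiniteDimensional ℂ E] [Nontrivial E] in
/-- A rational multiple of a member of a `ℚ`-subspace of forms is a member. [folklore] -/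
private theorem ratCast_smul_mem₄₇ {k : ℕ} {S : Submodule ℚ (E [⋀^Fin k]→L[ℝ] ℂ)} {T : E [⋀^Fin k]→L[ℝ] ℂ} (hT : T ∈ S) (q : ℚ) :
    ((q : ℂ)) • T ∈ S := by
  rw [Rat.cast_smul_eq_qsmul]
  exact S.smul_mem q hT

omit [Fintype ι] [DecidableEq ι] [FiniteDimensional ℂ E] [Nontrivial E] in
/-- `(−1)^{|m|} (−1)^{|m|} = 1`. [folklore] -/
private theorem neg_one_pow_natAbs_mul_self₄₇' (m : ℤ) : (-1 : ℂ) ^ m.natAbs * (-1) ^ m.natAbs = 1 := by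
  rw [← pow_add, ← two_mul, pow_mul, neg_one_sq, one_pow]

omit [Fintype ι] [DecidableEq ι] [FiniteDimensional ℂ E] [Nontrivial E] in
/-- `Lʳδ` for a rational primitive `δ` lies in the rational summand `Lʳ H^{m}(X, ℚ)_prim`, read in `Hᵏ(X, ℂ)`. [cite: Lange2023AbelianVarietiesComplex, §7.3.2 (3)] [cite: VoisinHodgeI2002, §7.1.2 (PDF p. 134)] -/
private theorem lefschetzPow_mem_map_lefschetzSummand₄₇ (hηQ : ofRealForm η ∈ rationalForms Φ 2) {k r m : ℕ} (h : 2 * r + m = k)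
    {δ : rationalForms Φ m} (hδ : (δ : E [⋀^Fin m]→L[ℝ] ℂ) ∈ primitiveRationalForms Φ η m) :
    lefschetzPow η r h (δ : E [⋀^Fin m]→L[ℝ] ℂ) ∈ (lefschetzSummand Φ hηQ k r).map (rationalForms Φ k).subtype := by
  rw [lefschetzSummand_eq Φ hηQ h]
  exact ⟨ratLefschetzPow Φ hηQ r h δ, Submodule.mem_map_of_mem (Submodule.mem_comap.2 hδ), rfl⟩

omit [Fintype ι] [DecidableEq ι] in
/-- **`w(Lʳ H^{s−2r}(X, ℚ)_prim) ⊆ L^{g−s+r} H^{s−2r}(X, ℚ)_prim`** (`η` rational non-degenerate; `s + t = 2g`, `r` in Milne's range of `Hˢ`, `r + g = r' + s`): a class `x = Lʳδ` with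
`δ ∈ H^{s−2r}(X, ℚ)_prim` is carried to `w(x)_t = (−1)^{r'} r!/r'! · L^{r'}δ` (p09's string formula, `r + r' = g − (s − 2r)`), a RATIONAL multiple of a member of the partner
rational summand — in every degree, below or above the middle, with no descent argument. [cite: VoisinHodgeI2002, §7.1.2 (PDF p. 134)] [cite: Beauville2010SL2, §5 Corollary]
[cite: Andre1996Motifs, §1.1–§1.2 (p. 10–11)] [cite: Lange2023AbelianVarietiesComplex, §7.3.2 (1)–(3) (p0338 L3–L16)] -/
theorem weylOperator_of_apply_mem_map_lefschetzSummand (hηQ : ofRealForm η ∈ rationalForms Φ 2) (hη : ∀ v : E, v ≠ 0 → ∃ w : E, η ![v, w] ≠ 0)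
    {s t r r' : ℕ} (hst : s + t = 2 * finrank ℂ E) (hr : r ∈ lefschetzRange (finrank ℂ E) s) (hrr' : r + finrank ℂ E = r' + s)
    {x : E [⋀^Fin s]→L[ℝ] ℂ} (hx : x ∈ (lefschetzSummand Φ hηQ s r).map (rationalForms Φ s).subtype) :
    (hasLefschetzProperty_lefschetzG hη).weylOperator isZGrading_countingG (GForm.of s x) t ∈ (lefschetzSummand Φ hηQ t r').map (rationalForms Φ t).subtype := by
  obtain ⟨hr₁, hr₂⟩ := mem_lefschetzRange.1 hr
  obtain ⟨m, hm⟩ : ∃ m, 2 * r + m = s := ⟨s - 2 * r, by omega⟩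
  have hm' : 2 * r' + m = t := by omega
  rw [lefschetzSummand_eq Φ hηQ hm] at hx
  obtain ⟨q, hq, rfl⟩ := Submodule.mem_map.1 hx
  obtain ⟨δ, hδ, rfl⟩ := Submodule.mem_map.1 hq
  rw [Submodule.mem_comap, Submodule.subtype_apply] at hδ
  rw [Submodule.subtype_apply, coe_ratLefschetzPow,
    weylOperator_of_lefschetzPow_of_mem_primitiveForms hη (show m + (r + r') = finrank ℂ E by omega) (mem_primitiveRationalForms_iff.1 hδ).2
      (rfl : r + r' = r + r') hm hm',
    Pi.smul_apply, GForm.of_apply_self,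
    show ((-1 : ℂ) ^ (r + r' + r) * ((r.factorial : ℕ) : ℂ) * ((r'.factorial : ℕ) : ℂ)⁻¹) =
      (((-1 : ℚ) ^ (r + r' + r) * (r.factorial : ℚ) * ((r'.factorial : ℚ))⁻¹ : ℚ) : ℂ) by push_cast; rfl]
  exact ratCast_smul_mem₄₇ (lefschetzPow_mem_map_lefschetzSummand₄₇ Φ hηQ hm' hδ) _

omit [Fintype ι] [DecidableEq ι] in
/-- **`w(Lʳ H^{s−2r}(X, ℚ)_prim) = L^{g−s+r} H^{s−2r}(X, ℚ)_prim`** as `ℚ`-subspaces of `Hᵗ(X, ℂ)` (`s + t = 2g`, `r` in Milne's range, `r + g = r' + s`): the image of the rational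
summand under `x ↦ w(of s x)_t` (`proj t ∘ w ∘ single s`, scalars restricted to `ℚ`) IS the partner rational summand — onto because `y ∈ L^{r'} H^{s−2r}(X, ℚ)_prim ⊂ Hᵗ` is
`w(x)_t` for `x = (−1)^{s−g} w(y)_s ∈ Lʳ H^{s−2r}(X, ℚ)_prim` (`w² = (−1)^{s−g}` on `Hˢ`, and `w` carries `Hᵗ` back by the same rule). THE WEYL ELEMENT OF THE LEFSCHETZ `𝔰𝔩₂`
PERMUTES THE RATIONAL LEFSCHETZ PIECES OF `H•(X, ℚ)`. [cite: VoisinHodgeI2002, §7.1.2 (PDF p. 134) and §6.2.3 Cor. 6.26] [cite: Andre1996Motifs, §1.2 (p. 11)] [cite: Beauville2010SL2, §4 Theorem, §5]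
[cite: Lange2023AbelianVarietiesComplex, §7.3.2 (1)–(3); §5.4.1 (5.22)] -/
theorem map_weylOperator_of_map_lefschetzSummand (hηQ : ofRealForm η ∈ rationalForms Φ 2) (hη : ∀ v : E, v ≠ 0 → ∃ w : E, η ![v, w] ≠ 0)
    {s t r r' : ℕ} (hst : s + t = 2 * finrank ℂ E) (hr : r ∈ lefschetzRange (finrank ℂ E) s) (hrr' : r + finrank ℂ E = r' + s) :
    ((lefschetzSummand Φ hηQ s r).map (rationalForms Φ s).subtype).map
        ((LinearMap.proj (φ := fun n : ℕ ↦ E [⋀^Fin n]→L[ℝ] ℂ) t ∘ₗ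
          (hasLefschetzProperty_lefschetzG hη).weylOperator isZGrading_countingG ∘ₗ
            LinearMap.single ℂ (fun n : ℕ ↦ E [⋀^Fin n]→L[ℝ] ℂ) s).restrictScalars ℚ) =
      (lefschetzSummand Φ hηQ t r').map (rationalForms Φ t).subtype := by
  obtain ⟨hr₁, hr₂⟩ := mem_lefschetzRange.1 hr
  have hr' : r' ∈ lefschetzRange (finrank ℂ E) t := mem_lefschetzRange.2 ⟨by omega, by omega⟩
  have hts : t + s = 2 * finrank ℂ E := by omega
  set W := (hasLefschetzProperty_lefschetzG hη).weylOperator isZGrading_countingG with hW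
  refine le_antisymm ?_ fun y hy ↦ ?_
  · rintro _ ⟨x, hx, rfl⟩
    exact weylOperator_of_apply_mem_map_lefschetzSummand Φ hηQ hη hst hr hrr' hx
  · -- the preimage `x = (−1)^{s−g} w(y)_s`
    have hx : W (GForm.of t y) s ∈ (lefschetzSummand Φ hηQ s r).map (rationalForms Φ s).subtype :=
      weylOperator_of_apply_mem_map_lefschetzSummand Φ hηQ hη hts hr' (by omega) hy
    have hWy : W (GForm.of t y) = GForm.of s (W (GForm.of t y) s) := weylOperator_of_eq_of hη hts y
    refine ⟨((-1 : ℂ) ^ ((s : ℤ) - (finrank ℂ E : ℤ)).natAbs) • W (GForm.of t y) s, ?_, ?_⟩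
    · rw [SetLike.mem_coe, show ((-1 : ℂ) ^ ((s : ℤ) - (finrank ℂ E : ℤ)).natAbs) = (((-1 : ℚ) ^ ((s : ℤ) - (finrank ℂ E : ℤ)).natAbs : ℚ) : ℂ) by push_cast; rfl]
      exact ratCast_smul_mem₄₇ hx _
    · show W (GForm.of s (((-1 : ℂ) ^ ((s : ℤ) - (finrank ℂ E : ℤ)).natAbs) • W (GForm.of t y) s)) t = y
      rw [GForm.of_smul, map_smul, ← hWy, hW,
        (hasLefschetzProperty_lefschetzG hη).weylOperator_weylOperator_apply_of_mem isZGrading_countingG (of_mem_degreeSpace_countingG (E := E) t y), smul_smul,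
        show ((t : ℤ) - (finrank ℂ E : ℤ)).natAbs = ((s : ℤ) - (finrank ℂ E : ℤ)).natAbs by omega, neg_one_pow_natAbs_mul_self₄₇', one_smul, GForm.of_apply_self]

omit [Fintype ι] [DecidableEq ι] in
/-- **`w : Lʳ H^{s−2r}(X, ℚ)_prim ⥲ L^{g−s+r} H^{s−2r}(X, ℚ)_prim` IS A BIJECTION** between the partner rational Lefschetz summands (onto by the previous identity, one-to-one on all
of `Hˢ(X, ℂ)`). [cite: VoisinHodgeI2002, §7.1.2 (PDF p. 134)] [cite: Andre1996Motifs, §1.2 (p. 11)] [cite: Beauville2010SL2, §4 Theorem, §5] -/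
theorem bijOn_weylOperator_of_map_lefschetzSummand (hηQ : ofRealForm η ∈ rationalForms Φ 2) (hη : ∀ v : E, v ≠ 0 → ∃ w : E, η ![v, w] ≠ 0)
    {s t r r' : ℕ} (hst : s + t = 2 * finrank ℂ E) (hr : r ∈ lefschetzRange (finrank ℂ E) s) (hrr' : r + finrank ℂ E = r' + s) :
    Set.BijOn (fun x : E [⋀^Fin s]→L[ℝ] ℂ ↦ (hasLefschetzProperty_lefschetzG hη).weylOperator isZGrading_countingG (GForm.of s x) t)
      ((lefschetzSummand Φ hηQ s r).map (rationalForms Φ s).subtype : Set (E [⋀^Fin s]→L[ℝ] ℂ))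
      ((lefschetzSummand Φ hηQ t r').map (rationalForms Φ t).subtype : Set (E [⋀^Fin t]→L[ℝ] ℂ)) := by
  refine ⟨fun x hx ↦ weylOperator_of_apply_mem_map_lefschetzSummand Φ hηQ hη hst hr hrr' hx, (weylOperator_of_apply_injective hη hst).injOn, fun y hy ↦ ?_⟩
  rw [SetLike.mem_coe, ← map_weylOperator_of_map_lefschetzSummand Φ hηQ hη hst hr hrr', Submodule.mem_map] at hy
  obtain ⟨x, hx, hxy⟩ := hy
  exact ⟨x, hx, hxy⟩

omit [Fintype ι] [DecidableEq ι] in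
/-- **For `η ∈ NS(X)` non-degenerate: `w(Lʳ H^{s−2r}(X, ℚ)_prim) = L^{g−s+r} H^{s−2r}(X, ℚ)_prim`** (the rational structure `hηQ` supplied by `IsNSForm.ofRealForm_mem_rationalForms`).
[cite: VoisinHodgeI2002, §7.1.2 (PDF p. 134)] [cite: Lange2023AbelianVarietiesComplex, §5.4.1 Thm. 5.4.2, (5.22); §7.3.2 (3)] -/
theorem IsNSForm.map_weylOperator_of_map_lefschetzSummand (hNS : IsNSForm Φ η) (hη : ∀ v : E, v ≠ 0 → ∃ w : E, η ![v, w] ≠ 0)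
    {s t r r' : ℕ} (hst : s + t = 2 * finrank ℂ E) (hr : r ∈ lefschetzRange (finrank ℂ E) s) (hrr' : r + finrank ℂ E = r' + s) :
    ((lefschetzSummand Φ (hNS.ofRealForm_mem_rationalForms Φ) s r).map (rationalForms Φ s).subtype).map
        ((LinearMap.proj (φ := fun n : ℕ ↦ E [⋀^Fin n]→L[ℝ] ℂ) t ∘ₗ
          (hasLefschetzProperty_lefschetzG hη).weylOperator isZGrading_countingG ∘ₗ
            LinearMap.single ℂ (fun n : ℕ ↦ E [⋀^Fin n]→L[ℝ] ℂ) s).restrictScalars ℚ) =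
      (lefschetzSummand Φ (hNS.ofRealForm_mem_rationalForms Φ) t r').map (rationalForms Φ t).subtype :=
  ComplexTorus.map_weylOperator_of_map_lefschetzSummand Φ _ hη hst hr hrr'

omit [Fintype ι] [DecidableEq ι] in
/-- **On a polarized complex torus (`η` a Riemann form): `w : Lʳ H^{s−2r}(X, ℚ)_prim ⥲ L^{g−s+r} H^{s−2r}(X, ℚ)_prim`** for the Weyl operator of the polarisation's `𝔰𝔩₂`.
[cite: VoisinHodgeI2002, §7.1.2 (PDF p. 134)] [cite: Beauville2010SL2, §4 Theorem, §5 Corollary] [cite: Lange2023AbelianVarietiesComplex, §7.3.2 (1)–(3)] -/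
theorem IsRiemannForm.bijOn_weylOperator_of_map_lefschetzSummand (hR : IsRiemannForm Φ η) {s t r r' : ℕ} (hst : s + t = 2 * finrank ℂ E)
    (hr : r ∈ lefschetzRange (finrank ℂ E) s) (hrr' : r + finrank ℂ E = r' + s) :
    Set.BijOn (fun x : E [⋀^Fin s]→L[ℝ] ℂ ↦
        (hasLefschetzProperty_lefschetzG (hR.exists_apply_ne_zero Φ)).weylOperator isZGrading_countingG (GForm.of s x) t)
      ((lefschetzSummand Φ ((hR.isNSForm Φ).ofRealForm_mem_rationalForms Φ) s r).map (rationalForms Φ s).subtype : Set (E [⋀^Fin s]→L[ℝ] ℂ))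
      ((lefschetzSummand Φ ((hR.isNSForm Φ).ofRealForm_mem_rationalForms Φ) t r').map (rationalForms Φ t).subtype : Set (E [⋀^Fin t]→L[ℝ] ℂ)) :=
  ComplexTorus.bijOn_weylOperator_of_map_lefschetzSummand Φ _ (hR.exists_apply_ne_zero Φ) hst hr hrr'

end ComplexTorus

end Literature.Geometry.Kaehler
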